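/-
Copyright (c) 2026 the pub-hodgecm-mathlib formalisation cell (harness21).  Prover seat hodgecm-mathlib-LH7-p05 (g0), req620 Track A «(D-RAM) FOUR-FRAME» squad, helper lane on
h413 = stmt-HodgeConjecture-24833 (count-neutral).  β-BOARD rows R8-EQ-a∕b — THE ∀-CLOSED LATTICE SCHEMA `hW` (EQW) of `hRest_of_heads` (β chair LEDGER #20), discharged from
this seat's two equilateral heads (strict window EQ-2d ★ p862295, locus EQ-3).  2026-09-04.
-/
import Summits.HodgeConjecture.HodgeConjecture.Theorems.F0P3cDyRamLabelledOddCoreHangingEquilateralWindow   -- ★ p862295 EQ-2d (this seat): the strict window `n₂ + 1 ≤ 2ρ + d % 2`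
import Summits.HodgeConjecture.HodgeConjecture.Theorems.F0P3cDyRamLabelledOddCoreHangingEquilateralLocus    -- EQ-3 (this seat): the locus `2ρ + d % 2 = n₂`
import Summits.HodgeConjecture.HodgeConjecture.Theorems.F0P3cDyRamStageOneBDerivedDefs                      -- ★ DEFS of record: `n0DerivedOfRecord`, `mcOfRecord_le_n0DerivedOfRecord`
import Summits.HodgeConjecture.HodgeConjecture.Theorems.F0P3cDyRamDiagonalKappaCoreHangingClass              -- ★ (LH4 lineage): `two_le_d_of_v_two_lt_one`
import HarnessLib

/-!
# Crux `H413`, line LH4 «(D-RAM) FOUR-FRAME» — (β) table, β-BOARD rows R8-EQ: THE SCHEMA `hW` (EQW) OF `hRest_of_heads`, CLOSED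

Cell `hodgecm-mathlib` (D-0151), FLOOR 0, crux item H413 = `stmt-HodgeConjecture-24833`, route `HCCMUnconditional`; squad F0∕P3c∕LH4 (β-table fan; β chair LH4-p05 (g9), LEDGER #20).
THEOREMS ONLY (no `def`, no instance, no notation, no `sorry`, default heartbeats); ★-only imports; lane `--supports stmt-HodgeConjecture-24833 --as helper` (count-neutral); pays NO
row, states NO law.

WHAT.  ★ p862244 `F0P3cDyRamOddLabelledRestOfHeads.hRest_of_heads (hK) (hW) (hB) (hZ)` takes four ∀-closed lattice schemas; `hW` is the EQUILATERAL WINDOW ZERO of the core-hanging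
stratum `H(ρ) = (2ρ, 2ρ, 2ρ)`: on the key `n₁ = n₂ = n₃` at `N₀ = n0DerivedOfRecord d`, for `1 ≤ ρ`, `n₂ ≤ 2ρ + d % 2`, `2ρ + mcOfRecord d ≤ 2·n₂`, the clean-shell cut of `H(ρ)` carries
labelled odd value `0`.  This seat's two heads prove exactly that, split at the locus: ★ p862295 `…CoreHangingEquilateralWindow.finsum_stratum_H_shell_labelledOdd_div_relIndex_eq_zero_of_
equilateral_window` (`n₂ + 1 ≤ 2ρ + d % 2`) and EQ-3 `…CoreHangingEquilateralLocus.finsum_stratum_H_shell_labelledOdd_div_relIndex_eq_zero_of_equilateral_locus` (`2ρ + d % 2 = n₂`);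
their side conditions `2 ≤ d` (★ `two_le_d_of_v_two_lt_one`), `d ≤ N₀`, `mcOfRecord d ≤ N₀` (★ `mcOfRecord_le_n0DerivedOfRecord`) hold at the derived threshold.  Hence
**`equilateralWindowSchema_H`**, whose TYPE is the `hW` binder of `hRest_of_heads` VERBATIM: `hRest_of_heads ‹hK› equilateralWindowSchema_H ‹hB› ‹hZ›`.

HONEST LABEL.  Count-neutral (`--supports`); nothing printed is asserted; the schemas `hB hZ`, hRest, (β) `stub_law_cleanSgn`, T₊ remain OPEN; `HC_CM` is proved only modulo the
7 printed citations (2 remaining named inputs: hLiu418 = `stmt-HodgeConjecture-24832`, h413 = `stmt-HodgeConjecture-24833`) until rung 0 closes.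
References: [Kottwitz1986BaseChangeUnits] §1 pp. 240–241 · [Rogawski1990] §4.9 Prop. 4.9.1 (a)(b) p. 55, §4.10 p. 58 · [LanglandsShelstad1987] §3 · [Serre1979] Ch. V §3, Ch. XV §2.
-/

set_option autoImplicit false

noncomputable section

namespace Summit.HodgeConjecture.HodgeConjecture.Cruxes.H413.F0P3cDyRamLabelledOddCoreHangingEquilateralSchema

open Matrix WithZero
open Literature.NumberTheory.Automorphic Literature.NumberTheory.Automorphic.HermitianLattice Literature.NumberTheory.Automorphic.UnitaryGroup
open Literature.NumberTheory.Automorphic.UnitaryLatticeTree Literature.NumberTheory.Automorphic.UnitaryThreeFourFrame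
open Literature.NumberTheory.LocalFields Literature.NumberTheory.LocalFields.WildQuadraticDatum
open Summit.HodgeConjecture.HodgeConjecture.Cruxes.H413.F0P3cDyRamFourFramePieces
open Summit.HodgeConjecture.HodgeConjecture.Cruxes.H413.F0P3cDyRamFourFrameCensusDefs
open Summit.HodgeConjecture.HodgeConjecture.Cruxes.H413.F0P3cDyRamStageOneBDefs (mcOfRecord)
open Summit.HodgeConjecture.HodgeConjecture.Cruxes.H413.F0P3cDyRamStageOneBDerivedDefs (n0DerivedOfRecord mcOfRecord_le_n0DerivedOfRecord)
open Summit.HodgeConjecture.HodgeConjecture.Cruxes.H413.F0P3cDyRamDiagonalTorusDefs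
open Summit.HodgeConjecture.HodgeConjecture.Cruxes.H413.F0P3cDyRamDiagonalStrataDefs
open Summit.HodgeConjecture.HodgeConjecture.Cruxes.H413.F0P3cDyRamLabelledOddCountDefs
open Summit.HodgeConjecture.HodgeConjecture.Cruxes.H413.F0P3cDyRamDiagonalKappaCoreHangingClass (two_le_d_of_v_two_lt_one)
open Summit.HodgeConjecture.HodgeConjecture.Cruxes.H413.F0P3cDyRamLabelledOddCoreHangingEquilateralWindow (finsum_stratum_H_shell_labelledOdd_div_relIndex_eq_zero_of_equilateral_window)
open Summit.HodgeConjecture.HodgeConjecture.Cruxes.H413.F0P3cDyRamLabelledOddCoreHangingEquilateralLocus (finsum_stratum_H_shell_labelledOdd_div_relIndex_eq_zero_of_equilateral_locus)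
open scoped Valued WithZero Matrix MatrixGroups

/-- **β-BOARD R8-EQ — THE SCHEMA `hW` (EQW) OF `hRest_of_heads`, CLOSED**: for every complete discretely valued `K` with finite residue field, every ramified datum with `|2| < 1`, every
element datum at `n0DerivedOfRecord d` on the equilateral key `n₁ = n₂ = n₃`, `T = diag(α, β, 1)`, every `ρ ≥ 1` in the window `n₂ ≤ 2ρ + d % 2`, `2ρ + mcOfRecord d ≤ 2·n₂`, and every slot
`i`: `Σᶠ_{M ∈ H(ρ) ∩ clean shell} labelledOddCount σ ϖ 0 i Λ M ∕ [𝒰 : N(S̃′(M))] = 0` — ★ EQ-2d below the locus (`n₂ < 2ρ + d % 2`) and EQ-3 at the locus (`2ρ + d % 2 = n₂`).  The type is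
`hRest_of_heads`'s `hW` binder VERBATIM. [cite: Kottwitz1986BaseChangeUnits, §1 pp. 240–241] [cite: Rogawski1990, §4.9 Prop. 4.9.1 (a)(b) p. 55, §4.10 p. 58] [cite: LanglandsShelstad1987, §3]
[cite: Serre1979, Ch. V §3, Ch. XV §2] -/
theorem equilateralWindowSchema_H :
    ∀ {K : Type} [Field K] [Valued K ℤᵐ⁰] [CompleteSpace K] [Fintype 𝓀[K]] (σ : K →+* K) (ϖ : K) (d t : ℕ),
      Valued.v (2 : K) < 1 → IsRamifiedQuadraticDatum σ ϖ d t →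
      ∀ (α β : K) (n₁ n₂ n₃ : ℕ), IsElementDatum σ ϖ (n0DerivedOfRecord d) α β n₁ n₂ n₃ →
      ∀ (T : GL (Fin 3) K), (T : Matrix (Fin 3) (Fin 3) K) = Matrix.diagonal ![α, β, 1] →
      n₁ = n₂ → n₂ = n₃ → ∀ ρ : ℕ, 1 ≤ ρ → n₂ ≤ 2 * ρ + d % 2 → 2 * ρ + mcOfRecord d ≤ 2 * n₂ → ∀ i : Fin 3,
      ∑ᶠ M ∈ {M : Submodule 𝒪[K] (Fin 3 → K) | M ∈ stratum σ ϖ T ![2 * ρ, 2 * ρ, 2 * ρ] ∧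
          (LatticeInLevel ϖ (d % 2) (Matrix.diagonal ![α - 1, β - 1, 0]) M ∧ ¬ LatticeInLevel ϖ (d % 2 + 1) (Matrix.diagonal ![α - 1, β - 1, 0]) M ∧
            LatticeInLevel ϖ (mcOfRecord d) (Matrix.diagonal ![(α - 1) * (α - 1), (β - 1) * (β - 1), 0]) M)},
        (labelledOddCount σ ϖ 0 i (valueClassLabel σ ϖ (α - 1) (β - 1) (mstarOfRecord d) d) M : ℚ) /
          ((((unitStabilizer M).map (unitNormMap σ 3)).relIndex (fixedUnitTorus σ 3) : ℕ) : ℚ) = 0 := by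
  intro K _ _ _ _ σ ϖ d t h2 hD α β n₁ n₂ n₃ hE T hT h12 h23 ρ hρ hlo hhi i
  have h2d : 2 ≤ d := two_le_d_of_v_two_lt_one hD h2
  have hmcN : mcOfRecord d ≤ n0DerivedOfRecord d := mcOfRecord_le_n0DerivedOfRecord d
  have hmcv : mcOfRecord d = 2 * ((d % 2 + 2 * d - 1 + d) / 2) := rfl
  have hdN : d ≤ n0DerivedOfRecord d := by omega
  rcases Nat.lt_or_ge n₂ (2 * ρ + d % 2) with hlt | hge
  · exact finsum_stratum_H_shell_labelledOdd_div_relIndex_eq_zero_of_equilateral_window hD h2 h2d hE hdN hmcN T hT ρ hρ h12 h23 (by omega) hhi i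
  · exact finsum_stratum_H_shell_labelledOdd_div_relIndex_eq_zero_of_equilateral_locus hD h2 h2d hE hdN hmcN T hT ρ hρ h12 h23 (by omega) hhi i

end Summit.HodgeConjecture.HodgeConjecture.Cruxes.H413.F0P3cDyRamLabelledOddCoreHangingEquilateralSchema

end
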